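import Summits.KontsevichZagierPeriods.KontsevichZagierPeriods.Theorems.TerasomaMultiplicationBetaCancellationEulerTerms
import Summits.KontsevichZagierPeriods.KontsevichZagierPeriods.Theorems.TerasomaMultiplicationBetaCancellationStubEulerRationalise
import Summits.KontsevichZagierPeriods.KontsevichZagierPeriods.Theorems.TerasomaMultiplicationBetaCancellationStubPiAsArctan
import Summits.KontsevichZagierPeriods.KontsevichZagierPeriods.Theses.CompiledSubstitutions

/-!
# Euler reflection inside the calculus (item stmt-KontsevichZagierPeriods-3383) — PROVED

`stub_eulerReflection : CompiledSubstitutions.EulerReflectionRational` (the registered stub of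
crux stmt-KontsevichZagierPeriods-13633, line `dirichlet-companion-to-pi`, and verbatim item
stmt-KontsevichZagierPeriods-3383 of route CompiledSubstitutions): for every rational `a ∈ (0,1)`,
`[(0,1), sin(πa)·x^{a-1}(1-x)^{-a}] ∼ [disc, 1]` by the Kontsevich–Zagier moves. Final part of the
lead's glue: split/reflect/rationalise (`beta_reduce`, via `stub_eulerRationalise`) and the
assembly with `eulerSide_reduce`, `piSide_reduce` and `stub_piAsArctan`.
-/

noncomputable section

-- `Summit.KontsevichZagierPeriods.KontsevichZagierPeriods.…` is the tree's mandated layout (single-conjunct summit).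
set_option linter.dupNamespace false

namespace Summit.KontsevichZagierPeriods.KontsevichZagierPeriods.BetaCancellationLine

open MeasureTheory Set
open Literature.NumberTheory.Transcendental
open Literature.NumberTheory.Transcendental.KZ
open Literature.ModelTheory.ExponentialFields (IsSemialgebraic isSemialgebraic_univ)
open MvPolynomial (aeval X C)
open Summit.KontsevichZagierPeriods.KontsevichZagierPeriods.Theses.CompiledSubstitutions
  (EulerReflectionRational)
open Summit.KontsevichZagierPeriods.KontsevichZagierPeriods.BetaCancellationNegative

/-! ## From the Beta kernel to the rational integrand (split, reflect, rationalise) -/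

/-- The reflected kernel representation `[(0,1), t^{(q-p)/q-1}(1-t)^{p/q-1}]`. [folklore] -/
def reflKernelRep (p q : ℕ) (hp : 0 < p) (hpq : p < q) : IntegralRep 1 :=
  intervalRep 0 1 (by simpa using isAlgebraic_nat 0) (by simpa using isAlgebraic_nat 1)
    (fun t => betaKernel (((q:ℚ) - p) / q) ((p:ℚ) / q) t)
    (by
      have hσ : IsSemialgebraic ℚ (Ioo1 0 1) := isSemialgebraic_Ioo1
        (by simpa using isAlgebraic_nat 0) (by simpa using isAlgebraic_nat 1)
      refine (isSemialgebraicFunOn_mellinIntegrand hσ ![X 0, 1 - X 0]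
        ![((q:ℚ) - p) / q - 1, (p:ℚ) / q - 1] 1 (fun x hx k => ?_)).congr fun x _ => ?_
      · simp only [mem_Ioo1, mem_Ioo] at hx
        fin_cases k <;> simp [hx.1, hx.2]
      · simp [mellinIntegrand, betaKernel, Fin.prod_univ_two])
    (by
      have hq : (0:ℚ) < q := by exact_mod_cast lt_of_le_of_lt (Nat.zero_le _) hpq
      have hqp : (0:ℚ) < (q:ℚ) - p := by
        have : (p:ℚ) < q := by exact_mod_cast hpq
        linarith
      have h1 : (0:ℚ) < ((q:ℚ) - p) / q := div_pos hqp hq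
      have h2 : (0:ℚ) < (p:ℚ) / q := div_pos (by exact_mod_cast hp) hq
      exact (integrableOn_betaKernel_and_integral_eq h1 h2).1)

/-- The domain of `reflKernelRep`. [folklore] -/
@[simp] theorem reflKernelRep_domain (p q : ℕ) (hp : 0 < p) (hpq : p < q) :
    (reflKernelRep p q hp hpq).domain = Ioo1 0 1 := rfl

/-- The integrand of `reflKernelRep`. [folklore] -/
@[simp] theorem reflKernelRep_integrand (p q : ℕ) (hp : 0 < p) (hpq : p < q) :
    (reflKernelRep p q hp hpq).integrand = fun x => betaKernel (((q:ℚ) - p) / q) ((p:ℚ) / q) (x 0) := rfl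

/-- The rational representation `[(0,1), q t^{k}/(1+t^q)]`. [folklore] -/
def ratRep (q k : ℕ) : IntegralRep 1 :=
  intervalRep 0 1 (by simpa using isAlgebraic_nat 0) (by simpa using isAlgebraic_nat 1)
    (fun t => (q:ℝ) * t ^ k / (1 + t ^ q))
    (by
      have hσ : IsSemialgebraic ℚ (Ioo1 0 1) := isSemialgebraic_Ioo1
        (by simpa using isAlgebraic_nat 0) (by simpa using isAlgebraic_nat 1)
      refine (isSemialgebraicFunOn_aeval_div_aeval hσ (C (q:ℚ) * X 0 ^ k) (1 + X 0 ^ q)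
        (fun x hx => ?_)).congr fun x _ => ?_
      · simp only [mem_Ioo1, mem_Ioo] at hx
        simp only [map_add, map_one, map_pow, MvPolynomial.aeval_X]
        have h := pow_pos hx.1 q
        exact ne_of_gt (by linarith)
      · simp)
    (by
      have hc : ContinuousOn (fun t : ℝ => (q:ℝ) * t ^ k / (1 + t ^ q)) (Set.Icc 0 1) := by
        refine ContinuousOn.div (by fun_prop) (by fun_prop) fun t ht => ?_
        have : 0 ≤ t ^ q := pow_nonneg ht.1 q
        positivity
      exact (hc.integrableOn_Icc).mono_set Ioo_subset_Icc_self)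

/-- The domain of `ratRep`. [folklore] -/
@[simp] theorem ratRep_domain (q k : ℕ) : (ratRep q k).domain = Ioo1 0 1 := rfl

/-- The integrand of `ratRep`. [folklore] -/
@[simp] theorem ratRep_integrand (q k : ℕ) :
    (ratRep q k).integrand = fun x => (q:ℝ) * (x 0) ^ k / (1 + (x 0) ^ q) := rfl

/-- `1/2` is algebraic. [folklore] -/
theorem isAlgebraic_half : IsAlgebraic ℚ ((1:ℝ) / 2) := by
  have := isAlgebraic_algebraMap (R := ℚ) (A := ℝ) (1 / 2 : ℚ)
  simpa using this

/-- **Split, reflect, rationalise**: for `0 < p < q`, any `κ = [(0,1), x^{p/q-1}(1-x)^{-p/q}]` and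
`F = [(0,1), q(x^{p-1}+x^{q-p-1})/(1+x^q)]` differ by a relation. [folklore] -/
theorem beta_reduce {p q : ℕ} (hp : 0 < p) (hpq : p < q) (κ F : IntegralRep 1) (hκ : κ.domain = Ioo1 0 1)
    (hκi : Set.EqOn κ.integrand (fun x => (x 0) ^ ((p:ℝ) / q - 1) * (1 - x 0) ^ (-((p:ℝ) / q))) κ.domain)
    (hF : F.domain = Ioo1 0 1)
    (hFi : Set.EqOn F.integrand (fun x => (q:ℝ) * ((x 0) ^ (p - 1) + (x 0) ^ (q - p - 1)) / (1 + (x 0) ^ q))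
      F.domain) :
    of κ - of F ∈ relations := by
  have hq : 0 < q := lt_of_le_of_lt (Nat.zero_le _) hpq
  have hq' : (q:ℝ) ≠ 0 := by exact_mod_cast hq.ne'
  have h0 : IsAlgebraic ℚ (0:ℝ) := by simpa using isAlgebraic_nat 0
  have h1 : IsAlgebraic ℚ (1:ℝ) := by simpa using isAlgebraic_nat 1
  have hh : IsAlgebraic ℚ ((1:ℝ) / 2) := isAlgebraic_half
  -- the pieces of `(0,1)`
  have hLsub : Ioo1 0 (1 / 2) ⊆ κ.domain := by
    rw [hκ]; intro x hx; exact ⟨hx.1, by linarith [hx.2]⟩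
  have hUsub : {x : Fin 1 → ℝ | x 0 ∈ Set.Ico (1 / 2 : ℝ) 1} ⊆ κ.domain := by
    rw [hκ]; intro x hx; exact ⟨by linarith [hx.1], hx.2⟩
  set κL := κ.restrict (Ioo1 0 (1 / 2)) (isSemialgebraic_Ioo1 h0 hh) hLsub with hκL
  set κU := κ.restrict {x : Fin 1 → ℝ | x 0 ∈ Set.Ico (1 / 2 : ℝ) 1} (isSemialgebraic_Ico1 hh h1) hUsub
    with hκU
  -- (1) domain additivity
  have s1 : of κ - of κL - of κU ∈ relations := by
    refine domainAddRel_subset_relations ⟨1, κ, κL, κU, ?_, ?_, fun _ _ => rfl, fun _ _ => rfl, rfl⟩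
    · rw [hκ]; ext x
      simp only [mem_Ioo1, mem_Ioo, hκL, hκU, IntegralRep.domain_restrict, mem_union, mem_setOf_eq, mem_Ico]
      constructor
      · rintro ⟨ha, hb⟩
        by_cases hx : x 0 < 1 / 2
        · exact Or.inl ⟨ha, hx⟩
        · exact Or.inr ⟨not_lt.1 hx, hb⟩
      · rintro (⟨ha, hb⟩ | ⟨ha, hb⟩)
        · exact ⟨ha, by linarith⟩
        · exact ⟨by linarith, hb⟩
    · refine measure_mono_null (fun x hx => ?_) (measure_empty (α := Fin 1 → ℝ))
      simp only [hκL, hκU, IntegralRep.domain_restrict, mem_inter_iff, mem_Ioo1, mem_Ioo, mem_setOf_eq,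
        mem_Ico] at hx
      linarith [hx.1.2, hx.2.1]
  -- (2) reflect the upper half
  set κb := reflKernelRep p q hp hpq with hκb
  have hL'sub : {x : Fin 1 → ℝ | x 0 ∈ Set.Ioc (0 : ℝ) (1 / 2)} ⊆ κb.domain := by
    intro x hx; exact ⟨hx.1, by linarith [hx.2]⟩
  have hIocsemi : IsSemialgebraic ℚ {x : Fin 1 → ℝ | x 0 ∈ Set.Ioc (0 : ℝ) (1 / 2)} :=
    isSemialgebraic_Ioc1 h0 hh
  set κbL' := κb.restrict {x : Fin 1 → ℝ | x 0 ∈ Set.Ioc (0 : ℝ) (1 / 2)} hIocsemi hL'sub with hκbL'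
  have hexp1 : (((((q:ℚ) - p) / q : ℚ)) : ℝ) - 1 = -((p:ℝ) / q) := by push_cast; field_simp; ring
  have hexp2 : ((((p:ℚ) / q : ℚ)) : ℝ) - 1 = (p:ℝ) / q - 1 := by push_cast; ring
  have s2 : of κU - of κbL' ∈ relations := by
    refine of_sub_of_mem_relations_of_boxReflection 0 ?_ fun x hx => ?_
    · ext x
      simp only [hκU, hκbL', IntegralRep.domain_restrict, mem_setOf_eq, mem_Ico, mem_preimage,
        boxReflection_apply_self, mem_Ioc]
      constructor
      · rintro ⟨ha, hb⟩; exact ⟨by linarith, by linarith⟩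
      · rintro ⟨ha, hb⟩; exact ⟨by linarith, by linarith⟩
    · have hx' : x ∈ κ.domain := hUsub hx
      simp only [hκU, hκbL', IntegralRep.integrand_restrict, hκb, reflKernelRep_integrand,
        boxReflection_apply_self]
      rw [hκi hx', betaKernel_one_sub]
      simp only [betaKernel, hexp1, hexp2]
  -- (3) drop the point `1/2`
  have hLsub' : Ioo1 0 (1 / 2) ⊆ κbL'.domain := fun x hx => ⟨hx.1, hx.2.le⟩
  have s3 : of κbL' - of (κbL'.restrict (Ioo1 0 (1 / 2)) (isSemialgebraic_Ioo1 h0 hh) hLsub') ∈ relations := by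
    refine κbL'.of_sub_of_restrict_mem_relations (isSemialgebraic_Ioo1 h0 hh) hLsub' ?_
    refine measure_mono_null (fun x hx => ?_) (volume_setOf_apply_eq_zero 0 (1 / 2))
    simp only [mem_sdiff, hκbL', IntegralRep.domain_restrict, mem_setOf_eq, mem_Ioc, mem_Ioo1, mem_Ioo,
      not_and, not_lt] at hx
    obtain ⟨⟨ha, hb⟩, hno⟩ := hx
    exact le_antisymm hb (hno ha)
  -- (4) rationalise both halves
  set G₁ := ratRep q (p - 1) with hG₁
  set G₂ := ratRep q (q - p - 1) with hG₂
  have s4 : of κL - of G₁ ∈ relations := by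
    refine stub_eulerRationalise p q hp hpq κL G₁ rfl (fun x hx => ?_) rfl (fun x _ => rfl)
    simp only [hκL, IntegralRep.integrand_restrict]
    exact hκi (hLsub hx)
  have hqp : 0 < q - p := by omega
  have hqpq : q - p < q := by omega
  have hcast : ((q - p : ℕ) : ℝ) = (q:ℝ) - p := Nat.cast_sub hpq.le
  have s5 : of (κbL'.restrict (Ioo1 0 (1 / 2)) (isSemialgebraic_Ioo1 h0 hh) hLsub') - of G₂ ∈ relations := by
    refine stub_eulerRationalise (q - p) q hqp hqpq _ G₂ rfl (fun x _ => ?_) rfl (fun x _ => rfl)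
    simp only [IntegralRep.integrand_restrict, hκbL', hκb, reflKernelRep_integrand, betaKernel, hcast]
    congr 1
    · congr 1; push_cast; field_simp
    · congr 1; push_cast; field_simp; ring
  -- (5) integrand additivity of the two rational pieces
  have s6 : of F - of G₁ - of G₂ ∈ relations := by
    refine integrandAddRel_subset_relations ⟨1, F, G₁, G₂, by rw [hF]; rfl, by rw [hF]; rfl,
      fun x hx => ?_, rfl⟩
    rw [hFi hx]
    simp only [Pi.add_apply, hG₁, hG₂, ratRep_integrand]
    ring
  have := relations.sub_mem (relations.add_mem (relations.add_mem (relations.add_mem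
    (relations.add_mem s1 s2) s3) s4) s5) s6
  convert this using 1
  abel


/-! ## Euler reflection -/

/-- Scaling twice by inverse constants. [folklore] -/
theorem constMul_constMul_eq' {n : ℕ} (r : IntegralRep n) {c : ℝ} (hc : IsAlgebraic ℚ c)
    (hc' : IsAlgebraic ℚ c⁻¹) (hc0 : c ≠ 0) : (r.constMul c⁻¹ hc').constMul c hc = r := by
  refine IntegralRep.ext' rfl ?_
  funext x
  simp only [IntegralRep.integrand_constMul]
  rw [← mul_assoc, mul_inv_cancel₀ hc0, one_mul]

/-- **Euler's reflection formula inside the Kontsevich–Zagier calculus** (item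
stmt-KontsevichZagierPeriods-3383, `CompiledSubstitutions.EulerReflectionRational`): for every rational
`a ∈ (0,1)`, `[(0,1), sin(πa)·x^{a-1}(1-x)^{-a}] ∼ [disc, 1]` — `B(a,1−a)·sin πa = π` by the
moves. One-dimensional chain: split/reflect/rationalise (`x = s^q/(1+s^q)`), real partial
fractions, affine moves onto arctan-type integrands, Möbius rotations onto the fundamental interval
`(0, tan(π/2q))`, the trigonometric weight count `Σ (q−2j−1)κ_j = 2q`, and the same reduction of
`[(-1,1), 2/(1+t²)] ∼ [disc, 1]`. [folklore] -/
theorem stub_eulerReflection :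
    Summit.KontsevichZagierPeriods.KontsevichZagierPeriods.Theses.CompiledSubstitutions.EulerReflectionRational := by
  intro a ha ha1 r P hr hri hP hPi
  -- `a = p/q`
  set p : ℕ := a.num.toNat with hpdef
  set q : ℕ := a.den with hqdef
  have hnum : 0 < a.num := Rat.num_pos.2 ha
  have hpz : (p : ℤ) = a.num := Int.toNat_of_nonneg hnum.le
  have hp : 0 < p := by omega
  have hpq : p < q := by
    have h := Rat.num_lt_denom_iff.2 ha1
    omega
  have hq : 0 < q := a.den_pos
  have hq1 : 1 < q := by omega
  have haq : (a:ℝ) = (p:ℝ) / q := by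
    rw [Rat.cast_def, hqdef]
    congr 1
    exact_mod_cast hpz.symm
  have hq' : (q:ℝ) ≠ 0 := by exact_mod_cast hq.ne'
  -- the constant `c = sin(πa) = sin(πp/q)`
  have hca : Real.sin (Real.pi * a) = Real.sin (Real.pi * p / q) := by rw [haq, mul_div_assoc]
  set c := Real.sin (Real.pi * p / q) with hc
  have hcalg : IsAlgebraic ℚ c := KoblitzOgus.isAlgebraic_sin_rat_mul_pi p hq
  have hc0 : 0 < c := by
    have hm : Real.pi * p / q ∈ Set.Ioo 0 Real.pi := by
      have hp' : (0:ℝ) < p := by exact_mod_cast hp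
      have hq'' : (0:ℝ) < q := by exact_mod_cast hq
      have hpq' : (p:ℝ) < q := by exact_mod_cast hpq
      refine ⟨by positivity, ?_⟩
      rw [div_lt_iff₀ hq'']; nlinarith [Real.pi_pos]
    exact Real.sin_pos_of_pos_of_lt_pi hm.1 hm.2
  -- (1) the kernel `κ = c⁻¹ · r`
  set κ := r.constMul c⁻¹ hcalg.inv with hκ
  have hκd : κ.domain = Ioo1 0 1 := by rw [hκ, IntegralRep.domain_constMul, hr]; rfl
  have hκi : Set.EqOn κ.integrand (fun x => (x 0) ^ ((p:ℝ) / q - 1) * (1 - x 0) ^ (-((p:ℝ) / q))) κ.domain := by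
    intro x hx
    have hx' : x ∈ r.domain := hx
    simp only [hκ, IntegralRep.integrand_constMul, hri hx', haq]
    have hsin : Real.sin (Real.pi * ((p:ℝ) / q)) = c := by rw [hc, mul_div_assoc]
    rw [hsin]
    field_simp
  -- (2) the rational representation and its scaled version
  set F := intervalRep 0 1 (by simpa using isAlgebraic_nat 0) (by simpa using isAlgebraic_nat 1)
    (fun t => (q:ℝ) * (t ^ (p - 1) + t ^ (q - p - 1)) / (1 + t ^ q))
    (by
      have hσ : IsSemialgebraic ℚ (Ioo1 0 1) := isSemialgebraic_Ioo1
        (by simpa using isAlgebraic_nat 0) (by simpa using isAlgebraic_nat 1)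
      refine (isSemialgebraicFunOn_aeval_div_aeval hσ (C (q:ℚ) * (X 0 ^ (p - 1) + X 0 ^ (q - p - 1)))
        (1 + X 0 ^ q) (fun x hx => ?_)).congr fun x _ => ?_
      · simp only [mem_Ioo1, mem_Ioo] at hx
        simp only [map_add, map_one, map_pow, MvPolynomial.aeval_X]
        have h := pow_pos hx.1 q
        exact ne_of_gt (by linarith)
      · simp)
    (by
      have hcn : ContinuousOn (fun t : ℝ => (q:ℝ) * (t ^ (p - 1) + t ^ (q - p - 1)) / (1 + t ^ q)) (Set.Icc 0 1) := by
        refine ContinuousOn.div (by fun_prop) (by fun_prop) fun t ht => ?_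
        have : 0 ≤ t ^ q := pow_nonneg ht.1 q
        positivity
      exact (hcn.integrableOn_Icc).mono_set Ioo_subset_Icc_self) with hF
  have s1 : of κ - of F ∈ relations := beta_reduce hp hpq κ F hκd hκi rfl (fun x _ => rfl)
  have s1' : of r - of (F.constMul c hcalg) ∈ relations := by
    have h := scale_mem_relations c hcalg s1
    rw [map_sub, scale_of, scale_of, hκ, constMul_constMul_eq' r hcalg hcalg.inv hc0.ne'] at h
    exact h
  -- (3) the Euler side down to the fundamental piece
  have htalg : IsAlgebraic ℚ (Real.tan (Real.pi / (2 * q))) := by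
    rw [tan_step_eq hq]; exact isAlgebraic_tan_ang hq 2
  have h0 : IsAlgebraic ℚ (0:ℝ) := by simpa using isAlgebraic_nat 0
  set Ztot := arctanRep 0 (Real.tan (Real.pi / (2 * q))) (2 * q) h0 htalg
    (by exact_mod_cast isAlgebraic_nat (2 * q)) with hZtot
  have s2 : of (F.constMul c hcalg) - of Ztot ∈ relations :=
    eulerSide_reduce hp hpq (F.constMul c hcalg) Ztot rfl (fun x _ => by simp [hF, hc]) rfl (fun x _ => rfl)
  -- (4) the π side
  have hm1 : IsAlgebraic ℚ (-1:ℝ) := by simpa using (isAlgebraic_nat 1).neg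
  have h1 : IsAlgebraic ℚ (1:ℝ) := by simpa using isAlgebraic_nat 1
  have h2 : IsAlgebraic ℚ (2:ℝ) := by exact_mod_cast isAlgebraic_nat 2
  set W := arctanRep (-1) 1 2 hm1 h1 h2 with hW
  set Z₂ := arctanRep 0 (Real.tan (Real.pi / (2 * q))) 2 h0 htalg h2 with hZ₂
  have s3 : of W - q • of Z₂ ∈ relations := piSide_reduce hq hq1 W Z₂ rfl (fun _ _ => rfl) rfl (fun _ _ => rfl)
  have s4 : of (Z₂.constMul (q:ℝ) (isAlgebraic_nat q)) - q • of Z₂ ∈ relations :=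
    of_constMul_nat_sub_nsmul_mem Z₂ q
  have s5 : of (Z₂.constMul (q:ℝ) (isAlgebraic_nat q)) - of Ztot ∈ relations := by
    refine of_sub_of_mem_relations_of_eqOn rfl fun x _ => ?_
    simp only [IntegralRep.integrand_constMul, hZ₂, hZtot, arctanRep_integrand]
    ring
  have s6 : of W - of P ∈ relations := stub_piAsArctan W P rfl (fun _ _ => rfl) hP hPi
  -- assemble
  have := relations.add_mem (relations.sub_mem (relations.add_mem (relations.sub_mem
    (relations.add_mem s1' s2) s5) s4) s3) s6
  show of r - of P ∈ relations
  convert this using 1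
  abel

end Summit.KontsevichZagierPeriods.KontsevichZagierPeriods.BetaCancellationLine
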